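import Literature.NumberTheory.EllipticCurves.IwasawaAlgebraProofs
import Mathlib.RingTheory.PowerSeries.Order
import Mathlib.RingTheory.PowerSeries.Inverse
import Mathlib.RingTheory.PowerSeries.NoZeroDivisors
import HarnessLib

/-!
# `μ` and `λ` of a power series over `ℤ_p`, and "(g·h) = (g) ⟺ μ, λ agree" (sub-cell `eisenstein-p1`, algebra part)

HONEST FRAMING (cell `b2b-bsdres`, run/shared/lean/b2b/bsd-rank1-residual/, verbatim in every
file): the goal of the cell is to DELETE the COMBINATION-SHAPED residual classes of the
Birch–Swinnerton-Dyer formula for ALL analytic-rank `≤ 1` elliptic curves over `ℚ` — "full BSD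
formula for every rank `≤ 1` curve in class `C`" assembled STRICTLY from published theorems — so
that the rank-`≤ 1` remainder becomes exactly the CONSTRUCTION-SHAPED classes, which are TYPED
(missing-input `Prop`s), NOT attempted. This is not "finishing BSD". Research route; NO CLAIM.

Pure algebra of `Λ = ℤ_p⟦T⟧` (everything PROVED, Mathlib only + the tree's `IwasawaAlgebra` API),
used by `X1/MuLambda.lean` to split Mazur's main conjecture at an X1 pair into its μ-part and
λ-part (Greenberg–Vatsal, Invent. Math. 142 (2000) p. 4; Greenberg LNM 1716 p. 180):
`mu g` = the exact power of `p` dividing `g` (Greenberg–Vatsal (2)); `pfree g` with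
`g = p^{μ(g)}·pfree g`, `pfree g ≢ 0 (mod p)`; `lam g` = the order of vanishing at `T = 0` of
`pfree g mod p` in `𝔽_p⟦T⟧` (= the Weierstrass degree, Washington §7.1); `mu_mul`, `lam_mul`
(additivity on nonzero elements: `𝔽_p⟦T⟧` is a domain), `isUnit_iff_mu_eq_zero_and_lam_eq_zero`,
and `span_eq_span_iff_mu_lam` / `span_eq_span_iff_mu_le_and_lam_le`: for `g ≠ 0`, `g' = g·h ≠ 0`,
`(g') = (g) ↔ μ(g') = μ(g) ∧ λ(g') = λ(g)` (Kato's direction `μ(g) ≤ μ(g')`, `λ(g) ≤ λ(g')` free).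

References: [GreenbergVatsal2000] (1)–(2), p. 4; [Washington1997] §7.1, §13.1–13.2.
-/

noncomputable section

open scoped Classical

open Literature.NumberTheory.EllipticCurves

set_option autoImplicit false

namespace Summit.BirchSwinnertonDyer.Rank1Residual.X1.MuLambda

/-! ## §1. `μ` and `λ` of a power series over `ℤ_p` -/

section Algebra

variable {p : ℕ} [Fact p.Prime]

/-- Reduction of `g ∈ Λ = ℤ_p⟦T⟧` modulo `p`: the image in `𝔽_p⟦T⟧` (coefficientwise residue map).
Washington §13.1 (`Λ/pΛ ≅ 𝔽_p⟦T⟧`). [folklore] -/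
abbrev red (g : IwasawaAlgebra p) : PowerSeries (IsLocalRing.ResidueField ℤ_[p]) :=
  PowerSeries.map (IsLocalRing.residue ℤ_[p]) g

/-- `red g = 0 ↔ p ∣ g` in `Λ`. [folklore] -/
theorem red_eq_zero_iff (g : IwasawaAlgebra p) :
    red g = 0 ↔ PowerSeries.C (p : ℤ_[p]) ∣ g := by
  rw [red, IwasawaAlgebra.map_residue_eq_zero_iff p g, IwasawaAlgebra.augIdealP,
    Ideal.mem_span_singleton]

/-- `C (p ^ n) = (C p) ^ n`. [folklore] -/
theorem C_pow_eq (n : ℕ) :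
    (PowerSeries.C ((p : ℤ_[p]) ^ n) : IwasawaAlgebra p) = PowerSeries.C (p : ℤ_[p]) ^ n :=
  map_pow _ _ _

/-- `C (p ^ n) ≠ 0` in `Λ`. [folklore] -/
theorem C_pow_ne_zero (n : ℕ) : (PowerSeries.C ((p : ℤ_[p]) ^ n) : IwasawaAlgebra p) ≠ 0 := by
  rw [Ne, ← map_zero (PowerSeries.C (R := ℤ_[p])), PowerSeries.C_injective.eq_iff]
  exact pow_ne_zero _ (by exact_mod_cast (Fact.out : p.Prime).ne_zero)

/-- The set of exponents `n` with `p ^ n ∣ g` is bounded above when `g ≠ 0` (by the valuation of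
any nonzero coefficient). [folklore] -/
theorem bddAbove_setOf_C_pow_dvd {g : IwasawaAlgebra p} (hg : g ≠ 0) :
    BddAbove {n : ℕ | PowerSeries.C ((p : ℤ_[p]) ^ n) ∣ g} := by
  obtain ⟨k, hk⟩ : ∃ k, PowerSeries.coeff k g ≠ 0 := by
    by_contra h
    push Not at h
    exact hg (PowerSeries.ext (by simpa using h))
  refine ⟨(PowerSeries.coeff k g).valuation, fun n hn => ?_⟩
  have hdvd : ((p : ℤ_[p]) ^ n) ∣ PowerSeries.coeff k g :=
    (Literature.NumberTheory.EllipticCurves.PowerSeries.C_dvd_iff_forall_dvd_coeff _ g).mp hn k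
  exact (PadicInt.mem_span_pow_iff_le_valuation _ hk n).mp (Ideal.mem_span_singleton.mpr hdvd)

/-- **The `μ`-invariant of `g ∈ Λ`**: the largest `n` with `p ^ n ∣ g` — Greenberg–Vatsal (2):
"`p^{μ}` is the exact power of `p` dividing `f(T)` in `Λ`" (junk value for `g = 0`).
[cite: GreenbergVatsal2000, p. 2, (2)] -/
def mu (g : IwasawaAlgebra p) : ℕ := sSup {n : ℕ | PowerSeries.C ((p : ℤ_[p]) ^ n) ∣ g}

/-- `p ^ μ(g) ∣ g`. [folklore] -/
theorem C_pow_mu_dvd {g : IwasawaAlgebra p} (hg : g ≠ 0) :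
    PowerSeries.C ((p : ℤ_[p]) ^ mu g) ∣ g := by
  have hne : ({n : ℕ | PowerSeries.C ((p : ℤ_[p]) ^ n) ∣ g} : Set ℕ).Nonempty := ⟨0, by simp⟩
  exact Nat.sSup_mem hne (bddAbove_setOf_C_pow_dvd hg)

/-- Maximality: `p ^ n ∣ g → n ≤ μ(g)`. [folklore] -/
theorem le_mu_of_C_pow_dvd {g : IwasawaAlgebra p} (hg : g ≠ 0) {n : ℕ}
    (hn : PowerSeries.C ((p : ℤ_[p]) ^ n) ∣ g) : n ≤ mu g :=
  le_csSup (bddAbove_setOf_C_pow_dvd hg) hn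

/-- **The `p`-free part**: `g = p^{μ(g)} · pfree g` with `pfree g ≢ 0 (mod p)` (for `g ≠ 0`; junk
`0` for `g = 0`). [folklore] -/
def pfree (g : IwasawaAlgebra p) : IwasawaAlgebra p :=
  if hg : g = 0 then 0 else Classical.choose (C_pow_mu_dvd hg)

/-- `g = C (p ^ μ g) * pfree g`. [folklore] -/
theorem eq_C_pow_mu_mul_pfree (g : IwasawaAlgebra p) :
    g = PowerSeries.C ((p : ℤ_[p]) ^ mu g) * pfree g := by
  by_cases hg : g = 0
  · simp [pfree, hg]
  · rw [pfree, dif_neg hg]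
    exact Classical.choose_spec (C_pow_mu_dvd hg)

/-- The `p`-free part of a nonzero `g` is not divisible by `p`: `red (pfree g) ≠ 0`. [folklore] -/
theorem red_pfree_ne_zero {g : IwasawaAlgebra p} (hg : g ≠ 0) : red (pfree g) ≠ 0 := by
  intro h
  rw [red_eq_zero_iff] at h
  obtain ⟨g₁, hg₁⟩ := h
  have : PowerSeries.C ((p : ℤ_[p]) ^ (mu g + 1)) ∣ g := by
    refine ⟨g₁, ?_⟩
    conv_lhs => rw [eq_C_pow_mu_mul_pfree g, hg₁]
    rw [pow_succ, map_mul, mul_assoc]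
  have := le_mu_of_C_pow_dvd hg this
  omega

/-- **The `λ`-invariant of `g ∈ Λ`**: the order of vanishing at `T = 0` of `(g / p^{μ(g)}) mod p`
in `𝔽_p⟦T⟧` — by Weierstrass preparation the degree of the distinguished polynomial of `g`
(Washington §7.1; Greenberg–Vatsal (1): `λ = deg f(T)`). [cite: GreenbergVatsal2000, p. 2–3, (1)–(2)] -/
def lam (g : IwasawaAlgebra p) : ℕ := (red (pfree g)).order.toNat

/-- Uniqueness of the decomposition `g = p^a · g₀` with `g₀ ≢ 0 (mod p)`. [folklore] -/
theorem eq_of_C_pow_mul_eq {a b : ℕ} {g₀ g₁ : IwasawaAlgebra p} (h₀ : red g₀ ≠ 0) (h₁ : red g₁ ≠ 0)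
    (h : PowerSeries.C ((p : ℤ_[p]) ^ a) * g₀ = PowerSeries.C ((p : ℤ_[p]) ^ b) * g₁) :
    a = b ∧ g₀ = g₁ := by
  -- reduce to `a ≤ b` by symmetry
  wlog hab : a ≤ b generalizing a b g₀ g₁
  · obtain ⟨hba, hg⟩ := this h₁ h₀ h.symm (le_of_not_ge hab)
    exact ⟨hba.symm, hg.symm⟩
  obtain ⟨d, rfl⟩ := Nat.exists_eq_add_of_le hab
  have hcancel : g₀ = PowerSeries.C ((p : ℤ_[p]) ^ d) * g₁ := by
    have h' : PowerSeries.C ((p : ℤ_[p]) ^ a) * g₀ =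
        PowerSeries.C ((p : ℤ_[p]) ^ a) * (PowerSeries.C ((p : ℤ_[p]) ^ d) * g₁) := by
      rw [h, pow_add, map_mul, mul_assoc]
    exact mul_left_cancel₀ (C_pow_ne_zero a) h'
  cases d with
  | zero => simpa using hcancel
  | succ d =>
    exfalso
    apply h₀
    rw [red_eq_zero_iff]
    exact ⟨PowerSeries.C ((p : ℤ_[p]) ^ d) * g₁, by rw [hcancel, pow_succ, map_mul]; ring⟩

/-- Characterisation of `μ` and `pfree`: if `g = p^a · g₀` with `g₀ ≢ 0 (mod p)` then `μ g = a` and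
`pfree g = g₀`. [folklore] -/
theorem mu_eq_and_pfree_eq {g g₀ : IwasawaAlgebra p} {a : ℕ} (h₀ : red g₀ ≠ 0)
    (h : g = PowerSeries.C ((p : ℤ_[p]) ^ a) * g₀) : mu g = a ∧ pfree g = g₀ := by
  have hg : g ≠ 0 := by
    rw [h]
    refine mul_ne_zero (C_pow_ne_zero a) ?_
    rintro rfl
    exact h₀ (by simp [red])
  have := eq_of_C_pow_mul_eq (red_pfree_ne_zero hg) h₀ ((eq_C_pow_mu_mul_pfree g).symm.trans h)
  exact this

/-- `pfree g ≠ 0` for `g ≠ 0`. [folklore] -/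
theorem pfree_ne_zero {g : IwasawaAlgebra p} (hg : g ≠ 0) : pfree g ≠ 0 := by
  intro h
  exact red_pfree_ne_zero hg (by simp [red, h])

/-- **`μ` is additive**: `μ(g·h) = μ(g) + μ(h)` for nonzero `g, h ∈ Λ` (Gauss's lemma:
`𝔽_p⟦T⟧` is a domain). [cite: Washington1997, §7.1 (Weierstrass preparation)] -/
theorem mu_mul {g h : IwasawaAlgebra p} (hg : g ≠ 0) (hh : h ≠ 0) : mu (g * h) = mu g + mu h := by
  have hred : red (pfree g * pfree h) ≠ 0 := by
    rw [red, map_mul]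
    exact mul_ne_zero (red_pfree_ne_zero hg) (red_pfree_ne_zero hh)
  have hfac : g * h = PowerSeries.C ((p : ℤ_[p]) ^ (mu g + mu h)) * (pfree g * pfree h) := by
    conv_lhs => rw [eq_C_pow_mu_mul_pfree g, eq_C_pow_mu_mul_pfree h]
    rw [pow_add, map_mul]; ring
  exact (mu_eq_and_pfree_eq hred hfac).1

/-- `pfree` is multiplicative on nonzero elements. [folklore] -/
theorem pfree_mul {g h : IwasawaAlgebra p} (hg : g ≠ 0) (hh : h ≠ 0) :
    pfree (g * h) = pfree g * pfree h := by
  have hred : red (pfree g * pfree h) ≠ 0 := by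
    rw [red, map_mul]
    exact mul_ne_zero (red_pfree_ne_zero hg) (red_pfree_ne_zero hh)
  have hfac : g * h = PowerSeries.C ((p : ℤ_[p]) ^ (mu g + mu h)) * (pfree g * pfree h) := by
    conv_lhs => rw [eq_C_pow_mu_mul_pfree g, eq_C_pow_mu_mul_pfree h]
    rw [pow_add, map_mul]; ring
  exact (mu_eq_and_pfree_eq hred hfac).2

/-- **`λ` is additive**: `λ(g·h) = λ(g) + λ(h)` for nonzero `g, h ∈ Λ` (orders add in the domain
`𝔽_p⟦T⟧`). [cite: Washington1997, §7.1 (Weierstrass preparation)] -/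
theorem lam_mul {g h : IwasawaAlgebra p} (hg : g ≠ 0) (hh : h ≠ 0) :
    lam (g * h) = lam g + lam h := by
  rw [lam, lam, lam, pfree_mul hg hh, red, map_mul, PowerSeries.order_mul]
  exact ENat.toNat_add (PowerSeries.order_finite_iff_ne_zero.mpr (red_pfree_ne_zero hg)).ne
    (PowerSeries.order_finite_iff_ne_zero.mpr (red_pfree_ne_zero hh)).ne

/-- Kato's direction is free: `μ(g) ≤ μ(g·h)`. [folklore] -/
theorem mu_le_mu_mul {g h : IwasawaAlgebra p} (hg : g ≠ 0) (hh : h ≠ 0) : mu g ≤ mu (g * h) := by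
  rw [mu_mul hg hh]; exact Nat.le_add_right _ _

/-- Kato's direction is free: `λ(g) ≤ λ(g·h)`. [folklore] -/
theorem lam_le_lam_mul {g h : IwasawaAlgebra p} (hg : g ≠ 0) (hh : h ≠ 0) :
    lam g ≤ lam (g * h) := by
  rw [lam_mul hg hh]; exact Nat.le_add_right _ _

/-- **Units of `Λ` are exactly the nonzero elements with `μ = λ = 0`** (a power series over the
local ring `ℤ_p` is a unit iff its constant term is a unit iff its constant term is nonzero mod `p`).
[cite: Washington1997, §7.1] -/
theorem isUnit_iff_mu_eq_zero_and_lam_eq_zero (h : IwasawaAlgebra p) :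
    IsUnit h ↔ h ≠ 0 ∧ mu h = 0 ∧ lam h = 0 := by
  constructor
  · intro hu
    have hne : h ≠ 0 := hu.ne_zero
    have hc : IsUnit (PowerSeries.constantCoeff h) := PowerSeries.isUnit_iff_constantCoeff.mp hu
    have hres : IsLocalRing.residue ℤ_[p] (PowerSeries.constantCoeff h) ≠ 0 := by
      rw [Ne, IsLocalRing.residue_eq_zero_iff]
      exact fun hm => (IsLocalRing.mem_maximalIdeal _).mp hm hc
    have hred0 : PowerSeries.coeff 0 (red h) ≠ 0 := by
      rwa [PowerSeries.coeff_map, PowerSeries.coeff_zero_eq_constantCoeff_apply]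
    have hredne : red h ≠ 0 := fun h0 => hred0 (by rw [h0, map_zero])
    have hdec : h = PowerSeries.C ((p : ℤ_[p]) ^ 0) * h := by simp
    obtain ⟨hmu, hpf⟩ := mu_eq_and_pfree_eq hredne hdec
    refine ⟨hne, hmu, ?_⟩
    rw [lam, hpf]
    have : (red h).order ≤ 0 := by
      simpa using PowerSeries.order_le (φ := red h) 0 hred0
    simp [nonpos_iff_eq_zero.mp this]
  · rintro ⟨hne, hmu, hlam⟩
    have hpf : pfree h = h := by
      have := eq_C_pow_mu_mul_pfree h
      rw [hmu, pow_zero, map_one, one_mul] at this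
      exact this.symm
    have hredne : red h ≠ 0 := by rw [← hpf]; exact red_pfree_ne_zero hne
    have hord : (red h).order = 0 := by
      rw [lam, hpf] at hlam
      have hfin : (red h).order ≠ ⊤ := (PowerSeries.order_finite_iff_ne_zero.mpr hredne).ne
      rcases ENat.toNat_eq_zero.mp hlam with h0 | htop
      · exact h0
      · exact absurd htop hfin
    have hred0 : PowerSeries.coeff 0 (red h) ≠ 0 := by
      have := PowerSeries.coeff_order hredne
      rwa [hord] at this
    rw [PowerSeries.coeff_map, PowerSeries.coeff_zero_eq_constantCoeff_apply] at hred0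
    apply PowerSeries.isUnit_iff_constantCoeff.mpr
    by_contra hnu
    exact hred0 ((IsLocalRing.residue_eq_zero_iff _).mpr ((IsLocalRing.mem_maximalIdeal _).mpr hnu))

/-- `(g') = (g)` with `g' = g·h`, `g ≠ 0` iff `h` is a unit (`Λ` is a domain). [folklore] -/
theorem span_eq_span_iff_isUnit {g g' h : IwasawaAlgebra p} (hg : g ≠ 0) (hfac : g' = g * h) :
    Ideal.span ({g'} : Set (IwasawaAlgebra p)) = Ideal.span {g} ↔ IsUnit h := by
  constructor
  · intro hspan
    obtain ⟨u, hu⟩ := Ideal.span_singleton_eq_span_singleton.mp hspan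
    -- `g' * u = g`, so `g * (h * u) = g * 1`
    have : g * (h * ↑u) = g * 1 := by rw [← mul_assoc, ← hfac, hu, mul_one]
    have hhu : h * ↑u = 1 := mul_left_cancel₀ hg this
    exact isUnit_iff_exists_inv.mpr ⟨_, hhu⟩
  · intro hu
    rw [hfac]
    exact Ideal.span_singleton_eq_span_singleton.mpr ((associated_mul_unit_right g h hu).symm)

/-- **The main conjecture as μ-part ∧ λ-part (pure algebra).** For `g ≠ 0` and `g' = g·h ≠ 0` in
`Λ`: `(g') = (g) ↔ μ(g') = μ(g) ∧ λ(g') = λ(g)` — Greenberg–Vatsal, p. 4 ("the equality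
`λ_alg = λ_an` implies that `f_alg` and `f_an` differ by multiplication by a power of `p`. The further
equality `μ_alg = μ_an` then implies the Main [statement (1.1)]"), with Kato's divisibility as the
factorisation `g' = g·h`. [cite: GreenbergVatsal2000, p. 4 (after Thm. (1.2))] -/
theorem span_eq_span_iff_mu_lam {g g' h : IwasawaAlgebra p} (hg : g ≠ 0) (hg' : g' ≠ 0)
    (hfac : g' = g * h) :
    Ideal.span ({g'} : Set (IwasawaAlgebra p)) = Ideal.span {g} ↔ mu g' = mu g ∧ lam g' = lam g := by
  have hh : h ≠ 0 := by rintro rfl; exact hg' (by rw [hfac, mul_zero])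
  rw [span_eq_span_iff_isUnit hg hfac, isUnit_iff_mu_eq_zero_and_lam_eq_zero, hfac, mu_mul hg hh,
    lam_mul hg hh]
  constructor
  · rintro ⟨-, hmu, hlam⟩; simp [hmu, hlam]
  · rintro ⟨hmu, hlam⟩; exact ⟨hh, by omega, by omega⟩

/-- One-inequality form: given `g' = g·h` (`g, g' ≠ 0`), `(g') = (g) ↔ μ(g') ≤ μ(g) ∧ λ(g') ≤ λ(g)`
(the reverse inequalities are automatic). [folklore] -/
theorem span_eq_span_iff_mu_le_and_lam_le {g g' h : IwasawaAlgebra p} (hg : g ≠ 0) (hg' : g' ≠ 0)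
    (hfac : g' = g * h) :
    Ideal.span ({g'} : Set (IwasawaAlgebra p)) = Ideal.span {g} ↔ mu g' ≤ mu g ∧ lam g' ≤ lam g := by
  have hh : h ≠ 0 := by rintro rfl; exact hg' (by rw [hfac, mul_zero])
  rw [span_eq_span_iff_mu_lam hg hg' hfac]
  have h1 := mu_le_mu_mul hg hh
  have h2 := lam_le_lam_mul hg hh
  rw [← hfac] at h1 h2
  constructor
  · rintro ⟨hmu, hlam⟩; exact ⟨hmu.le, hlam.le⟩
  · rintro ⟨hmu, hlam⟩; exact ⟨le_antisymm hmu h1, le_antisymm hlam h2⟩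

end Algebra

end Summit.BirchSwinnertonDyer.Rank1Residual.X1.MuLambda

end
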